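import Summits.BirchSwinnertonDyer.BirchSwinnertonDyer.Theorems.KimAtThreeStubSubdatum
import HarnessLib

/-!
# Route `KimAtThreeKolyvagin` (rung W2), crux `StubAtEmptyLevelThree` (item 19561): P-BLIND
# Selmer classes and `ℕ`-cyclicity of `KS₁` — the `∀`-sub-data quantifier, second instalment

Cell `bsd-addord`, seat `bsd-addord-w2-c5` (gen 2; item `stmt-BirchSwinnertonDyer-19561`).  TOOL
theorems (no definition, no named fact, no `sorry`; nothing is asserted about any curve beyond its
hypotheses).  Sequel to `KimAtThreeStubSubdatum` (p447489 / p447978).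

WHY.  The crux `KimAtThreeKolyvagin.StubAtEmptyLevelThree` quantifies over EVERY `τ`-datum `Dk` whose
primes form ANY subset `𝒫′` of a Sakamoto `τ`-class, and asks, WHEN `KS₁(E[3^{k+1}], 𝓕_can, 𝒫′)` is
`ℕ`-cyclic, for the stub shape of the generator's bottom class.  `KimAtThreeStubSubdatum` settled the
two extremes (a sub-datum keeping an injectivity vertex inherits the stub; a datum all of whose
primes are invisible to `H¹_{𝓕_can}` forces `n₀ = 0`).  This file shows that `ℕ`-CYCLICITY ITSELF
rules out every invisible class as soon as the datum has one prime:

* §1 (pure algebra) `KSBlind.exists_nsmul_eq_or_of_pow_smul_eq_zero` — the `ℕ`-multiples of an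
  element `g` killed by a prime power `p^m` form a CHAIN: of `a•g`, `a′•g` one is an `ℕ`-multiple of
  the other (write `a = p^α a₀`, `p ∤ a₀`, invert `a₀` modulo `p^m`); hence
  `KSBlind.eq_zero_of_nsmul_apply_eq` — if `a•g` and `a′•g` (for a family `g : ι → X`) carry the
  same value `b` on DISJOINT supports `{i}`, `{j}`, then `b = 0`.
* §2 (any number field, any finite discrete module, any datum `D` and structure `𝓕`)
  `KSBlind.isKolyvaginSystem_of_forall_localization_eq_zero` — EVERY family `κ` supported on the
  levels of `D` whose values are `𝒫(D)`-BLIND Selmer classes (`κ_d ∈ H¹_𝓕(K,T)`, `loc_𝔮 κ_d = 0` for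
  all `𝔮 ∈ 𝒫(D)`) is a Kolyvagin system: a blind class is transverse at every prime of every level
  (being `0` there) and both sides of every finite–singular relation vanish.  In particular
  (`KSBlind.isKolyvaginSystem_single`) the family `δ_{n,b}` carrying one blind class `b` at ONE level
  `n` and `0` elsewhere is a Kolyvagin system, so `KS₁(T,𝓕,𝒫) ⊇ ⊕_{n ∈ 𝒩} B(𝒫)` with
  `B(𝒫) := H¹_𝓕(K,T) ∩ ⋂_{𝔮 ∈ 𝒫} ker loc_𝔮`; ★ `KSBlind.eq_zero_of_forall_eq_nsmul` — if
  `KS₁(T,𝓕,𝒫) = ℕ•g` is `ℕ`-cyclic, `H¹(K,T)` is killed by a prime power and `𝒫 ≠ ∅`, then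
  `B(𝒫) = 0` (apply §1 to `δ_{∅,b}` and `δ_{{𝔮},b}`).
* §3 (`T = E[3^{k+1}]`, `𝓕 = 𝓕_can`, the crux's currency)
  ★ `eq_zero_of_forall_localization_eq_zero_of_forall_eq_nsmul` — under the crux's cyclicity binder,
  a datum with a Kolyvagin prime admits NO nonzero class of `H¹_{𝓕_can}(ℚ, E[3^{k+1}])` locally zero
  at all its primes; `primes_eq_empty_or_forall_blind_eq_zero` — the dichotomy; ★
  `exists_eq_nsmul_add_of_exists_blind` — the crux's conclusion for every datum admitting a nonzero
  blind class (then `𝒫 = ∅` and `KimAtThreeStubSubdatum.exists_eq_nsmul_add_of_primes_eq_empty`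
  applies), which strictly contains p447978's `exists_eq_nsmul_add_of_forall_localization_eq_zero`
  (ALL classes blind).
Reading for the item (memo `STUB19561-BLIND-w2c5g2.md`): an `ℕ`-cyclic sub-datum `𝒫′ ≠ ∅` sees
every class of `H¹_{𝓕_can}` — in particular (transporting `T^* ≅ T`, `𝓕_can^* ≤ 𝓕_can`) every
dual Selmer class — so at `m = 1` it contains a core vertex of the full datum and the stub
transfers (Mazur–Rubin's induction needs only dual visibility there); at `m ≥ 2` the residual
configuration is a core-vertex-free `𝒫′` with `B(𝒫′) = 0`.  What is NOT here: the stub for the full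
datum (Mazur–Rubin Thm. 4.4.1 / 4.4.3 road, conditional on Poitou–Tate and [S24]); core vertices.
[cite: MazurRubin2004, Def. 3.1.3 and Thm. 4.4.1] [cite: Sakamoto2024, Def. 3.3 (p. 922), Def. 4.1 and Thm. 4.4 (1) (p. 926)]
[cite: Rubin2011, Def. 2.2.1 (p. 18)]
-/

set_option autoImplicit false
-- the Theorems namespace of a single-conjunct summit repeats the summit name by design (D-0017)
set_option linter.dupNamespace false

noncomputable section

open scoped Classical NumberField ContRepresentation
open Function NumberField IsDedekindDomain WeierstrassCurve
  Literature.NumberTheory.EllipticCurves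
  Literature.NumberTheory.GaloisRepresentations
  Literature.NumberTheory.GaloisRepresentations.DiscreteGaloisModule Literature.NumberTheory.GaloisCohomology
  Summit.BirchSwinnertonDyer.Rank1Residual.GaloisImage

universe u

namespace Summit.BirchSwinnertonDyer.BirchSwinnertonDyer.Theorems.KimAtThreeStubBlindClasses

namespace KSBlind

/-! ## §1 Pure algebra: `ℕ`-multiples of an element of prime-power order form a chain -/

section Algebra

variable {X : Type*} [AddCommGroup X]

/-- **The `ℕ`-multiples of an element killed by `p^m` form a chain**: for `a, a′ : ℕ`, one of
`a•g`, `a′•g` is an `ℕ`-multiple of the other.  (Write `a = p^α a₀` with `p ∤ a₀`; `a₀` is invertible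
modulo `p^m`, so `a•g` and `p^α•g` generate the same cyclic subgroup; compare `α` with `α′`.)
[folklore] -/
theorem exists_nsmul_eq_or_of_pow_smul_eq_zero {p : ℕ} (hp : p.Prime) (m : ℕ) {g : X}
    (hg : p ^ m • g = 0) (a a' : ℕ) :
    (∃ c : ℕ, a • g = c • (a' • g)) ∨ (∃ c : ℕ, a' • g = c • (a • g)) := by
  -- a unit modulo `p` acts invertibly on `g`
  have key : ∀ u : ℕ, ¬ p ∣ u → ∃ i : ℕ, (u * i) • g = g := by
    intro u hu
    rcases Nat.eq_zero_or_pos m with rfl | hm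
    · refine ⟨0, ?_⟩
      rw [pow_zero, one_smul] at hg
      simp [hg]
    have hcop : Nat.Coprime u (p ^ m) := (hp.coprime_iff_not_dvd.mpr hu).symm.pow_right m
    obtain ⟨i, -, hi⟩ :=
      Nat.exists_mul_mod_eq_one_of_coprime hcop (Nat.one_lt_pow hm.ne' hp.one_lt)
    refine ⟨i, ?_⟩
    obtain ⟨t, ht⟩ : ∃ t : ℕ, u * i = p ^ m * t + 1 :=
      ⟨u * i / p ^ m, by have h := Nat.div_add_mod (u * i) (p ^ m); rw [hi] at h; exact h.symm⟩
    rw [ht, add_smul, one_smul, mul_comm (p ^ m) t, mul_smul, hg, smul_zero, zero_add]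
  rcases Nat.eq_zero_or_pos a with rfl | ha
  · exact Or.inl ⟨0, by simp⟩
  rcases Nat.eq_zero_or_pos a' with rfl | ha'
  · exact Or.inr ⟨0, by simp⟩
  obtain ⟨α, a₀, ha₀, rfl⟩ := Nat.exists_eq_pow_mul_and_not_dvd ha.ne' p hp.one_lt.ne'
  obtain ⟨α', a₀', ha₀', rfl⟩ := Nat.exists_eq_pow_mul_and_not_dvd ha'.ne' p hp.one_lt.ne'
  rcases le_total α α' with hle | hle
  · -- `a′ • g` is a multiple of `a • g`
    obtain ⟨d, rfl⟩ := Nat.exists_eq_add_of_le hle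
    obtain ⟨i, hi⟩ := key a₀ ha₀
    refine Or.inr ⟨p ^ d * a₀' * i, ?_⟩
    calc (p ^ (α + d) * a₀') • g = (p ^ (α + d) * a₀') • ((a₀ * i) • g) := by rw [hi]
      _ = (p ^ d * a₀' * i * (p ^ α * a₀)) • g := by rw [← mul_smul]; congr 1; ring
      _ = (p ^ d * a₀' * i) • ((p ^ α * a₀) • g) := mul_smul _ _ _
  · -- `a • g` is a multiple of `a′ • g`
    obtain ⟨d, rfl⟩ := Nat.exists_eq_add_of_le hle
    obtain ⟨i, hi⟩ := key a₀' ha₀'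
    refine Or.inl ⟨p ^ d * a₀ * i, ?_⟩
    calc (p ^ (α' + d) * a₀) • g = (p ^ (α' + d) * a₀) • ((a₀' * i) • g) := by rw [hi]
      _ = (p ^ d * a₀ * i * (p ^ α' * a₀')) • g := by rw [← mul_smul]; congr 1; ring
      _ = (p ^ d * a₀ * i) • ((p ^ α' * a₀') • g) := mul_smul _ _ _

/-- **Two `ℕ`-multiples of a family `g : ι → X` killed by `p^m` that carry the same value `b` on
disjoint one-point supports force `b = 0`**: if `(a•g) i = b`, `(a•g) j = 0`, `(a′•g) i = 0`,
`(a′•g) j = b`, then `b = 0` — by the chain property one of the two families is a multiple of the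
other, and evaluating at `i` (resp. `j`) gives `b = c • 0`. [folklore] -/
theorem eq_zero_of_nsmul_apply_eq {ι : Type*} {p : ℕ} (hp : p.Prime) (m : ℕ) {g : ι → X}
    (hg : p ^ m • g = 0) {i j : ι} {b : X} {a a' : ℕ}
    (hai : (a • g) i = b) (haj : (a • g) j = 0) (ha'i : (a' • g) i = 0) (ha'j : (a' • g) j = b) :
    b = 0 := by
  rcases exists_nsmul_eq_or_of_pow_smul_eq_zero hp m hg a a' with ⟨c, hc⟩ | ⟨c, hc⟩
  · rw [← hai, hc, Pi.smul_apply, ha'i, smul_zero]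
  · rw [← ha'j, hc, Pi.smul_apply, haj, smul_zero]

end Algebra

/-! ## §2 Blind classes give Kolyvagin systems at every level; `ℕ`-cyclicity kills them -/

section General

variable {K : Type u} [Field K] [NumberField K]
variable {M : Type u} [AddCommGroup M] [TopologicalSpace M] [DiscreteTopology M]
variable {ρ : DiscreteGaloisModule K M}

/-- **Every family of `𝒫`-blind Selmer classes on the levels is a Kolyvagin system.**  Let `κ`
vanish off the levels of `D`, and at every level `d` let `κ_d ∈ H¹_𝓕(K, T)` be locally ZERO at every
prime of `𝒫(D)`.  Then `κ ∈ KS₁(T, 𝓕, 𝒫(D))`: `κ_d ∈ H¹_{𝓕(d)}(K, T)` because the transverse condition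
at `𝔮 ∈ d` is met by `0` and `𝓕(d) = 𝓕` elsewhere (Sakamoto Def. 3.3), and the finite–singular
relation `v_𝔮(κ_{d𝔮}) = φ^{fs}_𝔮(loc_𝔮 κ_d)` (Def. 4.1) reads `0 = 0`.  No compatibility BETWEEN the
levels is required — the values may be chosen independently.
[cite: Sakamoto2024, Def. 3.3 (p. 922) and Def. 4.1 (p. 926)] [cite: Rubin2011, Def. 2.2.1 (p. 18)] -/
theorem isKolyvaginSystem_of_forall_localization_eq_zero (D : KolyvaginDatum ρ)
    (𝓕 : SelmerStructure ρ) {κ : Finset (HeightOneSpectrum (𝓞 K)) → galoisCohomology ρ 1}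
    (hoff : ∀ d, ¬ D.IsLevel d → κ d = 0)
    (hsel : ∀ d, D.IsLevel d → κ d ∈ 𝓕.selmerGroup)
    (hloc : ∀ d, D.IsLevel d → ∀ q ∈ D.primes,
      galoisCohomology.localization ρ (Sum.inr q) 1 (κ d) = 0) :
    D.IsKolyvaginSystem 𝓕 κ := by
  refine ⟨hoff, fun d hd => ?_, fun d hd q hq _ => ?_⟩
  · rw [SelmerStructure.mem_selmerGroup_iff]
    intro v
    rcases v with w | q
    · rw [CoreRankZero.Level.atLevel_inl]
      exact (SelmerStructure.mem_selmerGroup_iff _ _).1 (hsel d hd) (Sum.inl w)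
    · by_cases hqd : q ∈ d
      · rw [CoreRankZero.Level.atLevel_inr_of_mem D 𝓕 hqd, hloc d hd q (hd (Finset.mem_coe.2 hqd))]
        exact zero_mem _
      · rw [CoreRankZero.Level.atLevel_inr_of_not_mem D 𝓕 hqd]
        exact (SelmerStructure.mem_selmerGroup_iff _ _).1 (hsel d hd) (Sum.inr q)
  · have h1 : KolyvaginDatum.singularLocalization ρ q (κ (insert q d)) = 0 :=
      (congrArg (singularMap (GaloisRep.toLocal q ρ)) (hloc _ (hd.insert hq) q hq)).trans
        (map_zero _)
    have h2 : D.fsLocalization q (κ d) = 0 := (congrArg (D.fs q) (hloc d hd q hq)).trans (map_zero _)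
    rw [h1, h2]

/-- **A single `𝒫`-blind class at a single level is a Kolyvagin system**: for a level `n` of `D`
and `b ∈ H¹_𝓕(K, T)` with `loc_𝔮 b = 0` for all `𝔮 ∈ 𝒫(D)`, the family `δ_{n,b}` (`b` at `n`, `0`
elsewhere; Mathlib's `Pi.single n b`) lies in `KS₁(T, 𝓕, 𝒫(D))`.  Hence
`KS₁(T, 𝓕, 𝒫) ⊇ ⊕_{n ∈ 𝒩} B(𝒫)`, `B(𝒫)` the group of `𝒫`-blind Selmer classes.
[cite: Sakamoto2024, Def. 4.1 (p. 926)] [cite: MazurRubin2004, Def. 3.1.3] -/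
theorem isKolyvaginSystem_single (D : KolyvaginDatum ρ) (𝓕 : SelmerStructure ρ)
    {n : Finset (HeightOneSpectrum (𝓞 K))} (hn : D.IsLevel n)
    {b : galoisCohomology ρ 1} (hb : b ∈ 𝓕.selmerGroup)
    (hloc : ∀ q ∈ D.primes, galoisCohomology.localization ρ (Sum.inr q) 1 b = 0) :
    D.IsKolyvaginSystem 𝓕 (Pi.single n b) := by
  refine isKolyvaginSystem_of_forall_localization_eq_zero D 𝓕 (fun d hd => ?_) (fun d _ => ?_)
    (fun d _ q hq => ?_)
  · refine Pi.single_eq_of_ne (fun h => hd ?_) _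
    rw [h]
    exact hn
  · by_cases hdn : d = n
    · subst hdn
      rw [Pi.single_eq_same]
      exact hb
    · rw [Pi.single_eq_of_ne hdn]
      exact zero_mem _
  · by_cases hdn : d = n
    · subst hdn
      rw [Pi.single_eq_same]
      exact hloc q hq
    · rw [Pi.single_eq_of_ne hdn, map_zero]

/-- ★ **`ℕ`-cyclicity of `KS₁` kills every blind class as soon as there is one Kolyvagin prime.**
If every Kolyvagin system for `(T, 𝓕, 𝒫(D))` is an `ℕ`-multiple of one family `g`, `H¹(K, T)` is
killed by a prime power `p^m`, and `𝔮 ∈ 𝒫(D)`, then every `b ∈ H¹_𝓕(K, T)` with `loc_𝔮′ b = 0` for all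
`𝔮′ ∈ 𝒫(D)` is ZERO: `δ_{∅,b} = a•g` and `δ_{{𝔮},b} = a′•g` carry `b` on the disjoint supports `{∅}`,
`{{𝔮}}`, and §1 applies.  (So an `ℕ`-cyclic `KS₁(T, 𝓕, 𝒫)` with `𝒫 ≠ ∅` makes
`H¹_𝓕(K, T) → ∏_{𝔮 ∈ 𝒫} H¹(K_𝔮, T)` injective.)
[cite: Sakamoto2024, Def. 4.1 and Thm. 4.4 (1) (p. 926)] [cite: MazurRubin2004, Def. 3.1.3] -/
theorem eq_zero_of_forall_eq_nsmul (D : KolyvaginDatum ρ) (𝓕 : SelmerStructure ρ)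
    {p : ℕ} (hp : p.Prime) (m : ℕ) (hM : ∀ c : galoisCohomology ρ 1, p ^ m • c = 0)
    {g : Finset (HeightOneSpectrum (𝓞 K)) → galoisCohomology ρ 1}
    (hgen : ∀ κ ∈ D.kolyvaginSystems 𝓕, ∃ a : ℕ, κ = a • g)
    {q : HeightOneSpectrum (𝓞 K)} (hq : q ∈ D.primes)
    {b : galoisCohomology ρ 1} (hb : b ∈ 𝓕.selmerGroup)
    (hloc : ∀ q' ∈ D.primes, galoisCohomology.localization ρ (Sum.inr q') 1 b = 0) : b = 0 := by
  have hq' : D.IsLevel {q} := by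
    simpa [KolyvaginDatum.IsLevel] using hq
  obtain ⟨a, ha⟩ := hgen _ ((KolyvaginDatum.mem_kolyvaginSystems_iff _ _ _).2
    (isKolyvaginSystem_single D 𝓕 D.isLevel_empty hb hloc))
  obtain ⟨a', ha'⟩ := hgen _ ((KolyvaginDatum.mem_kolyvaginSystems_iff _ _ _).2
    (isKolyvaginSystem_single D 𝓕 hq' hb hloc))
  have hne : ({q} : Finset (HeightOneSpectrum (𝓞 K))) ≠ ∅ := Finset.singleton_ne_empty q
  have hg : p ^ m • g = 0 := funext fun d => by simpa using hM (g d)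
  refine eq_zero_of_nsmul_apply_eq hp m hg (i := (∅ : Finset (HeightOneSpectrum (𝓞 K))))
    (j := ({q} : Finset (HeightOneSpectrum (𝓞 K)))) (a := a) (a' := a') ?_ ?_ ?_ ?_
  · rw [← ha, Pi.single_eq_same]
  · rw [← ha, Pi.single_eq_of_ne hne]
  · rw [← ha', Pi.single_eq_of_ne hne.symm]
  · rw [← ha', Pi.single_eq_same]

end General

end KSBlind

/-! ## §3 The crux's currency: `T = E[3^{k+1}]`, `𝓕 = 𝓕_can` -/

variable (W : WeierstrassCurve ℚ) [W.IsElliptic]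

/-- ★ **Under the crux's cyclicity binder, a datum with a Kolyvagin prime admits no nonzero blind
class of `H¹_{𝓕_can}(ℚ, E[3^{k+1}])`.**  If `KS(E[3^{k+1}], 𝓕_can, 𝒫(Dk)) = ℕ•g` and `𝔮 ∈ 𝒫(Dk)`,
then every `b ∈ H¹_{𝓕_can}` locally zero at all primes of `Dk` vanishes (`H¹(ℚ, E[3^{k+1}])` is
killed by `3^{k+1}`, `Transport.pow_succ_nsmul_galoisCohomology`).
[cite: Sakamoto2024, Thm. 4.4 (1) (p. 926)] [cite: MazurRubin2004, Thm. 4.4.1] -/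
theorem eq_zero_of_forall_localization_eq_zero_of_forall_eq_nsmul (k : ℕ)
    {Dk : KolyvaginDatum (W.torsionGaloisModule (((3 : ℕ) : ℤ) ^ k * ((3 : ℕ) : ℤ)))}
    {g : Finset (HeightOneSpectrum (𝓞 ℚ)) →
      galoisCohomology (W.torsionGaloisModule (((3 : ℕ) : ℤ) ^ k * ((3 : ℕ) : ℤ))) 1}
    (hgen : ∀ κ ∈ Dk.kolyvaginSystems (propagatedSelmerStructure W 3 k), ∃ a : ℕ, κ = a • g)
    {q : HeightOneSpectrum (𝓞 ℚ)} (hq : q ∈ Dk.primes)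
    {b : galoisCohomology (W.torsionGaloisModule (((3 : ℕ) : ℤ) ^ k * ((3 : ℕ) : ℤ))) 1}
    (hb : b ∈ (propagatedSelmerStructure W 3 k).selmerGroup)
    (hloc : ∀ q' ∈ Dk.primes,
      galoisCohomology.localization (W.torsionGaloisModule (((3 : ℕ) : ℤ) ^ k * ((3 : ℕ) : ℤ)))
        (Sum.inr q') 1 b = 0) :
    b = 0 :=
  KSBlind.eq_zero_of_forall_eq_nsmul Dk _ Nat.prime_three (k + 1)
    (Transport.pow_succ_nsmul_galoisCohomology W k) hgen hq hb hloc

/-- **The dichotomy for the crux's data**: under the cyclicity binder, either `Dk` has no Kolyvagin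
prime at all, or `H¹_{𝓕_can}(ℚ, E[3^{k+1}])` has no nonzero class locally zero at all primes of `Dk`.
[cite: Sakamoto2024, Thm. 4.4 (1) (p. 926)] [cite: MazurRubin2004, Thm. 4.4.1] -/
theorem primes_eq_empty_or_forall_blind_eq_zero (k : ℕ)
    {Dk : KolyvaginDatum (W.torsionGaloisModule (((3 : ℕ) : ℤ) ^ k * ((3 : ℕ) : ℤ)))}
    {g : Finset (HeightOneSpectrum (𝓞 ℚ)) →
      galoisCohomology (W.torsionGaloisModule (((3 : ℕ) : ℤ) ^ k * ((3 : ℕ) : ℤ))) 1}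
    (hgen : ∀ κ ∈ Dk.kolyvaginSystems (propagatedSelmerStructure W 3 k), ∃ a : ℕ, κ = a • g) :
    Dk.primes = ∅ ∨ ∀ b ∈ (propagatedSelmerStructure W 3 k).selmerGroup,
      (∀ q ∈ Dk.primes,
        galoisCohomology.localization (W.torsionGaloisModule (((3 : ℕ) : ℤ) ^ k * ((3 : ℕ) : ℤ)))
          (Sum.inr q) 1 b = 0) → b = 0 := by
  rcases Set.eq_empty_or_nonempty Dk.primes with hP | ⟨q, hq⟩
  · exact Or.inl hP
  · exact Or.inr fun b hb hloc =>
      eq_zero_of_forall_localization_eq_zero_of_forall_eq_nsmul W k hgen hq hb hloc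

/-- ★ **The crux's conclusion for every datum admitting a nonzero blind class.**  In the currency of
`KimAtThreeKolyvagin.StubAtEmptyLevelThree`: if `KS(E[3^{k+1}], 𝓕_can, 𝒫(Dk)) = ℕ•g`,
`#H¹_{𝓕_can} = 3^{k+1}·3^{n₀}`, and SOME nonzero class of `H¹_{𝓕_can}(ℚ, E[3^{k+1}])` is locally zero
at every prime of `Dk`, then `g_∅ = 3^{n₀}•e + m` with `e ∈ H¹_{𝓕_can}`, `m ∈ H¹_𝓚` — for then
`𝒫(Dk) = ∅` (previous theorem) and `KimAtThreeStubSubdatum.exists_eq_nsmul_add_of_primes_eq_empty`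
applies (`n₀ = 0`, `e = g_∅`, `m = 0`).  Strictly contains p447978's
`exists_eq_nsmul_add_of_forall_localization_eq_zero` (ALL classes blind).
[cite: MazurRubin2004, Thm. 4.4.1 and Def. 3.1.3] [cite: Sakamoto2024, Def. 4.1 and Thm. 4.4 (1) (p. 926)] -/
theorem exists_eq_nsmul_add_of_exists_blind (k n₀ : ℕ)
    {Dk : KolyvaginDatum (W.torsionGaloisModule (((3 : ℕ) : ℤ) ^ k * ((3 : ℕ) : ℤ)))}
    {g : Finset (HeightOneSpectrum (𝓞 ℚ)) →
      galoisCohomology (W.torsionGaloisModule (((3 : ℕ) : ℤ) ^ k * ((3 : ℕ) : ℤ))) 1}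
    (hg : g ∈ Dk.kolyvaginSystems (propagatedSelmerStructure W 3 k))
    (hgen : ∀ κ ∈ Dk.kolyvaginSystems (propagatedSelmerStructure W 3 k), ∃ a : ℕ, κ = a • g)
    (hcard : Nat.card (propagatedSelmerStructure W 3 k).selmerGroup = 3 ^ (k + 1) * 3 ^ n₀)
    (hblind : ∃ b ∈ (propagatedSelmerStructure W 3 k).selmerGroup, b ≠ 0 ∧
      ∀ q ∈ Dk.primes,
        galoisCohomology.localization (W.torsionGaloisModule (((3 : ℕ) : ℤ) ^ k * ((3 : ℕ) : ℤ)))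
          (Sum.inr q) 1 b = 0) :
    ∃ e ∈ (propagatedSelmerStructure W 3 k).selmerGroup,
      ∃ m ∈ (W.kummerSelmerStructure (((3 : ℕ) : ℤ) ^ k * ((3 : ℕ) : ℤ))).selmerGroup,
        g ∅ = 3 ^ n₀ • e + m := by
  obtain ⟨b, hb, hb0, hloc⟩ := hblind
  rcases Set.eq_empty_or_nonempty Dk.primes with hP | ⟨q, hq⟩
  · exact KimAtThreeStubSubdatum.exists_eq_nsmul_add_of_primes_eq_empty W k n₀ hP hg hgen hcard
  · exact absurd (eq_zero_of_forall_localization_eq_zero_of_forall_eq_nsmul W k hgen hq hb hloc) hb0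

end Summit.BirchSwinnertonDyer.BirchSwinnertonDyer.Theorems.KimAtThreeStubBlindClasses

end
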